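import Literature.AlgebraicGeometry.HodgeTheory.AbelianVarietyIntegralCohomology
import HarnessLib

/-!
# `H•(A(ℂ); ℤ) = ⋀• H¹(A(ℂ); ℤ)` made explicit: every integral class is a sum of cup monomials of degree-one classes, the ring
# is generated in degree one, top classes are single monomials, and monomials of linearly dependent classes vanish — on the
# ALGEBRAIC Betti carrier

Layer `Literature/AlgebraicGeometry/HodgeTheory`, namespace `Literature.AlgebraicGeometry.HodgeTheory` (theorems about `A(ℂ)` in the
`AbelianVariety` namespace).  THEOREMS ONLY (no definition, no named fact, net debt 0).  The tree has the cup-monomial `ℤ`-bases of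
`Hᵏ(A(ℂ); ℤ)` (`AbelianVariety.exists_cupMonomial_bases`), the span statement `AbelianVariety.span_range_cupPowOne_int`, and the vanishing of
a monomial with a repeated entry (`cupPowOne_eq_zero_of_eq_of_sq_zero`); this file records the DECOMPOSITION statements that follow, phrased
without `ℤ`-scalars (coefficients are absorbed into a factor by multilinearity), and the vanishing of monomials of `ℤ`-linearly dependent
families (the monomial map is alternating on `A(ℂ)` because `v ⌣ v = 0` over `ℤ`, and `Hᵏ(A(ℂ); ℤ)` is torsion-free).

A. Hatcher, *Algebraic Topology* (2002), §3.2 Example 3.16: `H*(Tⁿ; ℤ) = Λ_ℤ[α₁, …, α_n]`, «with basis the products `α_{i₁} ⌣ ⋯ ⌣ α_{i_k}`,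
`i₁ < ⋯ < i_k`»; H. Lange, *Abelian Varieties over the Complex Numbers* (2023), §1.1.3 Lemma 1.1.17 («the canonical map
`⋀ⁿ H¹(X, ℤ) → Hⁿ(X, ℤ)` induced by the cup product is an isomorphism») and Exercise 1.1.6 (7)–(8); D. Mumford, *Abelian Varieties* (1970),
§1 (3)–(4).

## What is proved

For `A : AbelianVariety ℂ` (`g = A.dim`), on `singularCohomology ℤ ℤ (ComplexPoints A.X) k`:

* §0 plumbing (any commutative semiring): `MultilinearMap.exists_smul_apply_eq` — `c • f(v) = f(w)` for some `w` (absorb `c` into a slot);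
* §1 **`exists_eq_sum_cupPowOne`** — every `z ∈ Hᵏ(A(ℂ); ℤ)`, `k ≥ 1`, is a sum of `C(2g, k)` cup monomials `v₁ ⌣ ⋯ ⌣ v_k` of degree-one
  classes, indexed by the `k`-subsets of `Fin 2g`; **`exists_eq_sum_cupProduct_one`** — every class of degree `k + 1` is a sum of products
  `v ⌣ x` with `v ∈ H¹`; `span_range_cupProduct_one_eq_top` (`H¹ ⌣ Hᵏ` spans `H^{k+1}`: the ring is generated in degree one over `ℤ`);
* §2 top degree: **`exists_eq_cupPowOne_top`** — every `z ∈ H^{2g}(A(ℂ); ℤ)` is a SINGLE monomial `v₁ ⌣ ⋯ ⌣ v_{2g}`;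
  `exists_span_cupPowOne_singleton_eq_top` — some monomial generates `H^{2g}(A(ℂ); ℤ)`;
* §3 **`cupPowOne_eq_zero_of_not_linearIndependent`** — `v₁ ⌣ ⋯ ⌣ v_k = 0` for every `ℤ`-linearly dependent family (Mathlib's
  `AlternatingMap.map_linearDependent` for the alternating monomial map), `cupPowOne_eq_zero_of_two_mul_dim_lt` (any `k > 2g` classes).

## References

* [HatcherAT2002] A. Hatcher, *Algebraic Topology*, CUP 2002 — §3.2 Example 3.16 (and Example 3.11 for `T²`).
* [Lange2023AbelianVarietiesComplex] H. Lange, *Abelian Varieties over the Complex Numbers*, Springer 2023 — §1.1.3 Lemma 1.1.17, Exercise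
  1.1.6 (7)–(8) (PDF pp. 23, 27).
* [MumfordAV1970] D. Mumford, *Abelian Varieties* (1970) — §1 (3)–(4).

## Provenance
Lane `lit-hodgefound` (Hodge path, Track 2), prover seat `lit-hodgefound-p21` (generation 43), self-proposed row g43-#8 (CLAIM BY PATH).
-/

noncomputable section

open Module Function
open Literature.AlgebraicTopology.SingularHomology

universe u v

namespace Literature.AlgebraicGeometry.HodgeTheory

open Literature.AlgebraicGeometry.Motives (AbelianVariety ComplexPoints IsSmoothProjective)

/-! ### §0 Plumbing: absorbing a scalar into one slot of a multilinear map -/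

/-- **`c • f(v) = f(v')`** with `v' = v` updated in slot `i` by `c • vᵢ` (multilinearity).  Stated for a general commutative semiring so that the
scalar action is the module action (no `ℤ`-specific `zsmul` in the statement). Private plumbing. [folklore] -/
private theorem _root_.MultilinearMap.exists_smul_apply_eq {R : Type*} [CommSemiring R] {ι : Type*} [DecidableEq ι] {M N : Type*}
    [AddCommMonoid M] [Module R M] [AddCommMonoid N] [Module R N] (f : MultilinearMap R (fun _ : ι ↦ M) N) (i : ι) (c : R) (v : ι → M) :
    ∃ w : ι → M, c • f v = f w :=
  ⟨Function.update v i (c • v i), by rw [f.map_update_smul, Function.update_eq_self]⟩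

namespace AbelianVariety

variable (A : AbelianVariety ℂ)

/-! ### §1 Every class is a sum of `C(2g, k)` cup monomials; the ring is generated in degree one -/

/-- **EVERY INTEGRAL CLASS OF DEGREE `k ≥ 1` ON `A(ℂ)` IS A SUM OF `C(2g, k)` CUP MONOMIALS OF DEGREE-ONE CLASSES**: for `z ∈ Hᵏ(A(ℂ); ℤ)` there are
families `s_t = (v_{t,1}, …, v_{t,k})` of classes in `H¹(A(ℂ); ℤ)`, one for each `k`-subset `t` of `Fin 2g`, with `z = Σ_t v_{t,1} ⌣ ⋯ ⌣ v_{t,k}` —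
expand `z` in the cup-monomial basis `ξ_{i₁} ⌣ ⋯ ⌣ ξ_{i_k}` (`i₁ < ⋯ < i_k`) and absorb each coefficient into the first factor.
[cite: HatcherAT2002, §3.2 Example 3.16] [cite: Lange2023AbelianVarietiesComplex, §1.1.3 Lemma 1.1.17 and Exercise 1.1.6 (7) (PDF pp. 23, 27)] -/
theorem exists_eq_sum_cupPowOne {k : ℕ} (hk : k ≠ 0) (z : singularCohomology ℤ ℤ (ComplexPoints A.X) k) :
    ∃ s : Set.powersetCard (Fin (2 * A.dim)) k → (Fin k → singularCohomology ℤ ℤ (ComplexPoints A.X) 1),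
      z = ∑ t, cupPowOne ℤ (ComplexPoints A.X) k (s t) := by
  obtain ⟨ξ, hξ⟩ := exists_cupMonomial_bases A
  obtain ⟨b, hb⟩ := hξ k
  have key := fun t : Set.powersetCard (Fin (2 * A.dim)) k ↦
    (cupPowOne ℤ (ComplexPoints A.X) k).exists_smul_apply_eq ⟨0, Nat.pos_of_ne_zero hk⟩ (b.repr z t) (ξ ∘ subsetEmb t)
  choose s hs using key
  refine ⟨s, ?_⟩
  conv_lhs => rw [← b.sum_repr z]
  refine Finset.sum_congr rfl fun t _ ↦ ?_
  rw [hb, ← cupPowOne_comp_eq_cupMonomial]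
  exact hs t

/-- **Every class of degree `k + 1` is a sum of products `v ⌣ x` with `v ∈ H¹(A(ℂ); ℤ)`, `x ∈ Hᵏ(A(ℂ); ℤ)`** (`C(2g, k+1)` of them):
`v₁ ⌣ (v₂ ⌣ ⋯ ⌣ v_{k+1})`. [cite: HatcherAT2002, §3.2 Example 3.16] [cite: Lange2023AbelianVarietiesComplex, §1.1.3 Lemma 1.1.17 (PDF p. 23)] -/
theorem exists_eq_sum_cupProduct_one (k : ℕ) (z : singularCohomology ℤ ℤ (ComplexPoints A.X) (k + 1)) :
    ∃ (v : Set.powersetCard (Fin (2 * A.dim)) (k + 1) → singularCohomology ℤ ℤ (ComplexPoints A.X) 1)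
      (x : Set.powersetCard (Fin (2 * A.dim)) (k + 1) → singularCohomology ℤ ℤ (ComplexPoints A.X) k),
      z = ∑ t, cupProduct (Nat.add_comm 1 k) (v t) (x t) := by
  obtain ⟨s, hs⟩ := exists_eq_sum_cupPowOne A k.succ_ne_zero z
  refine ⟨fun t ↦ s t 0, fun t ↦ cupPowOne ℤ (ComplexPoints A.X) k (Fin.tail (s t)), ?_⟩
  rw [hs]
  exact Finset.sum_congr rfl fun t _ ↦ cupPowOne_succ ℤ (ComplexPoints A.X) k (s t)

/-- **`H¹(A(ℂ); ℤ) ⌣ Hᵏ(A(ℂ); ℤ)` SPANS `H^{k+1}(A(ℂ); ℤ)`** — the integral cohomology ring of a complex abelian variety is generated in degree one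
(«the canonical map `⋀ⁿ H¹(X, ℤ) → Hⁿ(X, ℤ)` induced by the cup product is an isomorphism»). [cite: Lange2023AbelianVarietiesComplex, §1.1.3 Lemma 1.1.17 (PDF p. 23)]
[cite: HatcherAT2002, §3.2 Example 3.16] -/
theorem span_range_cupProduct_one_eq_top (k : ℕ) :
    Submodule.span ℤ (Set.range fun p : singularCohomology ℤ ℤ (ComplexPoints A.X) 1 × singularCohomology ℤ ℤ (ComplexPoints A.X) k ↦
      cupProduct (Nat.add_comm 1 k) p.1 p.2) = ⊤ := by
  refine eq_top_iff.2 ?_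
  rw [← span_range_cupPowOne_int A (k + 1)]
  refine Submodule.span_mono ?_
  rintro _ ⟨v, rfl⟩
  exact ⟨(v 0, cupPowOne ℤ (ComplexPoints A.X) k (Fin.tail v)), (cupPowOne_succ ℤ (ComplexPoints A.X) k v).symm⟩

/-! ### §2 Top degree `2g`: every class is a single monomial -/

/-- The set of `2g`-subsets of `Fin 2g` has exactly one element (`C(2g, 2g) = 1`): it is a subsingleton and non-empty. Private plumbing. [folklore] -/
private theorem subsingleton_nonempty_powersetCard_self (n : ℕ) :
    Subsingleton (Set.powersetCard (Fin n) n) ∧ Nonempty (Set.powersetCard (Fin n) n) := by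
  have h1 : Fintype.card (Set.powersetCard (Fin n) n) = 1 := by rw [card_powersetCard_fin, Nat.choose_self]
  exact ⟨Fintype.card_le_one_iff_subsingleton.1 h1.le, Fintype.card_pos_iff.1 (by omega)⟩

/-- **EVERY TOP-DEGREE INTEGRAL CLASS ON `A(ℂ)` IS A CUP MONOMIAL**: for `z ∈ H^{2g}(A(ℂ); ℤ)`, `g ≥ 1`, there are `v₁, …, v_{2g} ∈ H¹(A(ℂ); ℤ)` with
`z = v₁ ⌣ ⋯ ⌣ v_{2g}` (`H^{2g} = ⋀^{2g} H¹ ≅ ℤ` is spanned by the single monomial `ξ₁ ⌣ ⋯ ⌣ ξ_{2g}`, and `n·(ξ₁ ⌣ ⋯) = (nξ₁) ⌣ ⋯`).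
[cite: MumfordAV1970, §1 (3)–(4)] [cite: Lange2023AbelianVarietiesComplex, §1.1.3 Lemma 1.1.17 and Exercise 1.1.6 (8) (PDF pp. 23, 27)] -/
theorem exists_eq_cupPowOne_top (hA : A.dim ≠ 0) (z : singularCohomology ℤ ℤ (ComplexPoints A.X) (2 * A.dim)) :
    ∃ v : Fin (2 * A.dim) → singularCohomology ℤ ℤ (ComplexPoints A.X) 1, z = cupPowOne ℤ (ComplexPoints A.X) (2 * A.dim) v := by
  obtain ⟨s, hs⟩ := exists_eq_sum_cupPowOne A (by omega) z
  obtain ⟨hsub, ⟨t₀⟩⟩ := subsingleton_nonempty_powersetCard_self (2 * A.dim)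
  exact ⟨s t₀, by rw [hs, Fintype.sum_subsingleton _ t₀]⟩

/-- **Some monomial `v₁ ⌣ ⋯ ⌣ v_{2g}` generates `H^{2g}(A(ℂ); ℤ)`** (as a `ℤ`-module; it is a basis vector of the rank-one lattice `H^{2g}(A(ℂ); ℤ)`).
[cite: MumfordAV1970, §1 (3)–(4)] [cite: Lange2023AbelianVarietiesComplex, §1.1.3 Exercise 1.1.6 (8) (PDF p. 27)] -/
theorem exists_span_cupPowOne_singleton_eq_top :
    ∃ v : Fin (2 * A.dim) → singularCohomology ℤ ℤ (ComplexPoints A.X) 1,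
      Submodule.span ℤ {cupPowOne ℤ (ComplexPoints A.X) (2 * A.dim) v} = ⊤ := by
  obtain ⟨ξ, hξ⟩ := exists_cupMonomial_bases A
  obtain ⟨b, hb⟩ := hξ (2 * A.dim)
  obtain ⟨hsub, ⟨t₀⟩⟩ := subsingleton_nonempty_powersetCard_self (2 * A.dim)
  refine ⟨ξ ∘ subsetEmb t₀, ?_⟩
  have hr : Set.range b = {cupPowOne ℤ (ComplexPoints A.X) (2 * A.dim) (ξ ∘ subsetEmb t₀)} := by
    ext y
    simp only [Set.mem_range, Set.mem_singleton_iff]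
    constructor
    · rintro ⟨t, rfl⟩
      rw [Subsingleton.elim t t₀, hb, cupPowOne_comp_eq_cupMonomial]
    · rintro rfl
      exact ⟨t₀, by rw [hb, cupPowOne_comp_eq_cupMonomial]⟩
  rw [← hr, b.span_eq]

/-! ### §3 Monomials of linearly dependent classes vanish -/

/-- **`v₁ ⌣ ⋯ ⌣ v_k = 0` WHENEVER `v₁, …, v_k ∈ H¹(A(ℂ); ℤ)` ARE `ℤ`-LINEARLY DEPENDENT**: on `A(ℂ)` the monomial map is alternating over `ℤ`
(`v ⌣ v = 0`, `AbelianVariety.cupProduct_self_eq_zero_int`, hence it vanishes on families with a repeated entry) and `Hᵏ(A(ℂ); ℤ)` is torsion-free,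
so Mathlib's `AlternatingMap.map_linearDependent` applies. [cite: HatcherAT2002, §3.2 Example 3.16] [cite: Lange2023AbelianVarietiesComplex, §1.1.3 Lemma 1.1.17 (b) (PDF p. 23)] -/
theorem cupPowOne_eq_zero_of_not_linearIndependent {k : ℕ} (v : Fin k → singularCohomology ℤ ℤ (ComplexPoints A.X) 1)
    (hv : ¬ LinearIndependent ℤ v) : cupPowOne ℤ (ComplexPoints A.X) k v = 0 := by
  haveI := isTorsionFree_singularCohomology_int A k
  let f : singularCohomology ℤ ℤ (ComplexPoints A.X) 1 [⋀^Fin k]→ₗ[ℤ] singularCohomology ℤ ℤ (ComplexPoints A.X) k :=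
    { cupPowOne ℤ (ComplexPoints A.X) k with
      map_eq_zero_of_eq' := fun w i j hw hij ↦ cupPowOne_eq_zero_of_eq_of_sq_zero (cupProduct_self_eq_zero_int A) k w i j hw hij }
  exact f.map_linearDependent v hv

/-- **Any `k > 2g` degree-one classes have zero product** (`k` classes in the rank-`2g` lattice `H¹(A(ℂ); ℤ)` are dependent; consistent with
`Hᵏ(A(ℂ); ℤ) = 0` for `k > 2g`). [cite: Lange2023AbelianVarietiesComplex, §1.1.3 Exercise 1.1.6 (8) (PDF p. 27)] [cite: HatcherAT2002, §3.2 Example 3.16] -/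
theorem cupPowOne_eq_zero_of_two_mul_dim_lt {k : ℕ} (hk : 2 * A.dim < k) (v : Fin k → singularCohomology ℤ ℤ (ComplexPoints A.X) 1) :
    cupPowOne ℤ (ComplexPoints A.X) k v = 0 := by
  refine cupPowOne_eq_zero_of_not_linearIndependent A v fun hli ↦ ?_
  haveI := free_singularCohomology_int A 1
  haveI := finite_singularCohomology_int A 1
  have h := hli.fintype_card_le_finrank
  rw [Fintype.card_fin, finrank_singularCohomology_int_one] at h
  omega

end AbelianVariety

end Literature.AlgebraicGeometry.HodgeTheory

end
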